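import Literature.NumberTheory.Automorphic.LocalOrbitalIntegral
import Mathlib.Data.Complex.Basic
import HarnessLib

/-!
# Kottwitz 1986, §7 «Local finiteness results» — Proposition 7.1, 7.2, Corollary 7.3, 7.4, Proposition 7.5
# (pp. 385–389)

Topic `Literature/NumberTheory/Kottwitz1986` (carpet of R. E. Kottwitz, *Stable trace formula: elliptic singular terms*,
Math. Ann. 275 (1986) 365–399 [Kottwitz1986]; source of record = the GDZ Göttingen open-access digitisation
(store key `paper:url-ecbc59a1db27`; per-page OCR `HOME/lit/lit3/g0/texts/Kottwitz1986-GDZ/p0385.txt … p0389.txt`,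
canvas = printed page + 6; page images `T/KOT/TK-t06/g0/Kottwitz1986-GDZ/img/p0385.jpg`, `p0387.jpg` READ for the
displays of 7.1 and 7.3). STATEMENTS ONLY (named facts, D-0014) and one definition with body (`heckeAlgebra`): no
theorem, no `sorry`, no `axiom`, no `instance`, no `notation`. Namespace
`Literature.NumberTheory.Kottwitz1986.LocalFiniteness` (squad TK file map, DEAL v1.1, 2026-09-02).

## The printed statements (pp. 385–387)

«In this section `F` is a `p`-adic field, `𝔬` is the valuation ring of `F`, `k` is the residue field of `𝔬`, `k̄` is an
algebraic closure of `k`, and `G` is an unramified connected reductive group over `F`. Let `x₀` be a hyperspecial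
point in the building of `G`, and let 𝐆 be the corresponding extension of `G` to a group scheme over `𝔬` [T]. We
write `K` for the hyperspecial maximal compact subgroup `𝐆(𝔬) = Stab_{G(F)}(x₀)` of `G(F)`.

**7.1. Proposition.** Let `γ` be a semi-simple element of `K` such that `1 − α(γ) ∈ 𝔬_F̄` is either `0` or a unit for
every root `α` of `G`, and let `I = G_γ⁰`. Then `I` is unramified and `I(F) ∩ K` is a hyperspecial maximal compact
subgroup of `I(F)`. Furthermore, `ker[H¹(F, I) → H¹(F, G_γ)]` is trivial. Finally, if `γ' ∈ K` is stably conjugate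
to `γ`, then `γ'` is conjugate to `γ` under `K`.

**7.2.** Assume that `γ ∈ K` satisfies the hypothesis of 7.1. Let `f_K` denote the characteristic function of the
subset `K` of `G(F)`. Let `dg` (respectively `di`) be a Haar measure on `G(F)` [respectively `I(F)`] that gives
measure `1` to `K` [respectively `I(F) ∩ K`]. Let `γ'` be a stable conjugate of `γ` and form the orbital integral
`O_{γ'}(f_K)` using `dg/di'`, where `di'` is the measure on `I'(F)` obtained from `di`.

**7.3. Corollary.** The orbital integral `O_{γ'}(f_K)` vanishes unless `γ'` is conjugate to `γ`, in which case it
equals `1`.» Proof, p. 387: «We have `O_γ(f_K) = meas I(F)\X` where `X = {g ∈ G(F) | g⁻¹γg ∈ K}` … we see that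
`X = I(F) · K` in general. Therefore `O_γ(f_K) = meas(K) · meas(I(F) ∩ K)⁻¹ = 1`.»

«**7.4.** For simplicity we assume that `G_der` is simply connected for the rest of Sect. 7. Let `(H, s, η)` be an
endoscopic triple for `G`. Let `γ_H` be a semi-simple `(G, H)`-regular element of `H(F)` and let `γ` be a
corresponding element of `G(F)`, as in 3.1. Let `I = G_γ` and let `κ` be the element of `𝔎(I/F)` obtained from `s` as
in 5.6. Then we can form `κ`-orbital integrals `O^κ_γ` (again see 5.6).

**7.5. Proposition.** Assume that `H` is not an unramified group. Let `f` belong to the Hecke algebra `ℌ(G(F), K)`.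
Then `O^κ_γ(f) = 0`.»

## DEDUP (squad list: «Prop 7.1 in 119 files, Cor 7.3 in 22»)

All existing tree carriers of «Kottwitz1986, Prop. 7.1 / Cor. 7.3» are INSTANCES in concrete groups, proved as
theorems — cited here by name, not restated: the `GL_N` case of the last clause of 7.1 and of `X = I(F)·K`
(★ `Literature.LinearAlgebra.Matrix.exists_isUnit_det_conj_of_charpoly_eq`,
★ `…Matrix.mem_range_map_mul_centralizer_of_conj_mem_range`, file `IntegralConjugacyOfRegularElements`); the
unramified-unitary case (★ `Literature.LinearAlgebra.Matrix.exists_integral_unitary_conj_of_charpoly_eq`, file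
`IntegralUnitaryConjugacyOfRegularElements`); Cor. 7.3 on the unitary groups `U(H)(L⁺_v)` of the cell
(★ `Literature.NumberTheory.Rogawski1990.UnramifiedStableOrbitalUnitFactorSemisimple`, ★
`Literature.NumberTheory.Automorphic.UnitOrbitalIntegralFixedPointsVolume`). The GENERAL statements for an arbitrary
unramified reductive `G` were not in the tree (`Literature/NumberTheory/Kottwitz1986/` did not exist); they are
typed here once.

## What is vendored, and in which vocabulary

ONE posited datum `LocalFinitenessData GF` (squad ruling V1): `GF = G(F)` is a type PARAMETER with its group
structure and topology (instance parameters; no instance is declared), so that `K`, «conjugate under `K`»,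
`X = {g | g⁻¹γg ∈ K} = I(F)·K`, the characteristic function `f_K`, the Hecke algebra `ℌ(G(F), K)` (`heckeAlgebra`,
DEFINED: compactly supported bi-`K`-invariant `f : G(F) → ℂ`) and the orbital integral `O_{γ'}(f_K)` (the tree's
★ `Literature.NumberTheory.Automorphic.orbitalIntegral γ' f m`) are CONCRETE; posited are the scheme-theoretic
notions Lean lacks (semisimplicity, the root condition of 7.1, stable conjugacy, `I(F)` for `I = G_γ⁰`, «`I` is
unramified», «hyperspecial in `I(F)`», «`ker[H¹(F, I) → H¹(F, G_γ)]` is trivial», the orbital measure `dg/di'` of 7.2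
pushed to `G(F) ⧸ C(γ')`, and for 7.4–7.5 the endoscopic triples, «`H` unramified», the `(G, H)`-regular semisimple
`γ_H ∈ H(F)`, «corresponds», the `κ`-orbital integral). Relations: `Kottwitz1986_7_1`, `Kottwitz1986_7_3_conjSet`
(the proof's `X = I(F)·K`), `Kottwitz1986_7_3`, `Kottwitz1986_7_5`.

VACUITY / JUNK audit: no defaulted field; the only `Prop`-valued FIELD is the standing hypothesis `DerSimplyConnected`
(7.4, used as an antecedent of 7.5 only); orbital integrals are Bochner integrals against the posited measure (the
facts assert the printed values `0`/`1` for the book's `dg/di'`).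

## What is NOT here

The proofs (pp. 385–389: smoothness of 𝐆_γ over `𝔬` [SGA 3], Lemma 19 of [H], `z`-extensions; the diagram chase with
`G₁ = (G × C')/Z(G)` for 7.5); §5.6 (`κ`-orbital integrals) and §3.1 («corresponds») are posited as fields, their
carpets being other squad-TK files (`LocalConjectures`, `RegularAndSigns`).

## References

* R. E. Kottwitz, *Stable trace formula: elliptic singular terms*, Math. Ann. 275 (1986) 365–399: §7, Prop. 7.1
  (p. 385), 7.2–7.5 (p. 387), proofs pp. 385–389. [Kottwitz1986]
* J. D. Rogawski, *Automorphic Representations of Unitary Groups in Three Variables* (1990), §4.9 p. 54 (orbital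
  integrals; the tree's `orbitalIntegral`). [Rogawski1990]
-/

noncomputable section

open MeasureTheory
open scoped Pointwise

namespace Literature.NumberTheory.Kottwitz1986.LocalFiniteness

open Literature.NumberTheory.Automorphic (orbitalIntegral)

universe u

/-! ## §1 The Hecke algebra `ℌ(G(F), K)` (definition) -/

/-- **The Hecke algebra `ℌ(G(F), K)`** of a subgroup `K` of a topological group, as a set of test functions:
compactly supported, bi-`K`-invariant `f : G(F) → ℂ` (for `K` compact open these are the locally constant compactly
supported bi-`K`-invariant functions). [cite: Kottwitz1986, §7.5 (p. 387)] -/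
def heckeAlgebra {GF : Type u} [Group GF] [TopologicalSpace GF] (K : Subgroup GF) : Set (GF → ℂ) :=
  {f | HasCompactSupport f ∧ ∀ k₁ ∈ K, ∀ k₂ ∈ K, ∀ g : GF, f (k₁ * g * k₂) = f g}

/-! ## §2 The posited datum of §7 -/

/-- **The data of Kottwitz's §7 AS A DATUM.** Fixed behind it (not fields): the `p`-adic field `F`, `𝔬`, `k`, `k̄`,
the unramified connected reductive `F`-group `G`, the hyperspecial point `x₀` and the `𝔬`-model 𝐆 (p. 385).
PARAMETER: `GF = G(F)` with its group structure and topology (instance parameters) and a σ-algebra on each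
`G(F) ⧸ C(γ)` (for the orbital integrals). Fields: `K = 𝐆(𝔬)`; «semi-simple»; the root condition of 7.1; stable
conjugacy; `I(F) ⊆ G(F)` for `I = G_γ⁰`; «`I` is unramified»; «is a hyperspecial maximal compact subgroup of
`I(F)`»; «`ker[H¹(F, I) → H¹(F, G_γ)]` is trivial»; the orbital measure of 7.2 (`dg/di'`, `dg(K) = 1`,
`di(I(F) ∩ K) = 1`, `di'` transported to `I'(F)`) as a measure on `G(F) ⧸ C(γ')` (push-forward along
`I'(F)\G(F) → C(γ')\G(F)`; the integrand `g ↦ f_K(g⁻¹γ'g)` is `C(γ')`-invariant); and for 7.4–7.5: «`G_der` simply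
connected», the endoscopic triples `(H, s, η)`, «`H` is unramified», the semisimple `(G, H)`-regular `γ_H ∈ H(F)`,
«`γ` corresponds to `γ_H`» (3.1), and the `κ`-orbital integral `O^κ_γ(f)` (5.6). No field asserts a printed
statement. [cite: Kottwitz1986, §7 (pp. 385–387)] -/
structure LocalFinitenessData (GF : Type u) [Group GF] [TopologicalSpace GF]
    [∀ γ : GF, MeasurableSpace (GF ⧸ Subgroup.centralizer ({γ} : Set GF))] : Type (u + 1) where
  /-- the hyperspecial maximal compact subgroup `K = 𝐆(𝔬) = Stab_{G(F)}(x₀)` [§7 p. 385] -/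
  K : Subgroup GF
  /-- «semi-simple element» of `G(F)` [Prop. 7.1 p. 385] -/
  IsSemisimple : GF → Prop
  /-- the hypothesis of 7.1: «`1 − α(γ) ∈ 𝔬_F̄` is either `0` or a unit for every root `α` of `G`» [Prop. 7.1 p. 385] -/
  RootCondition : GF → Prop
  /-- stable conjugacy in `G(F)` [Prop. 7.1 p. 385] -/
  IsStConj : GF → GF → Prop
  /-- `I(F) ⊆ G(F)`, the `F`-points of the connected centralizer `I = G_γ⁰` [Prop. 7.1 p. 385] -/
  IF : GF → Subgroup GF
  /-- «`I = G_γ⁰` is unramified» [Prop. 7.1 p. 385] -/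
  CentUnramified : GF → Prop
  /-- «is a hyperspecial maximal compact subgroup of `I(F)`», `I = G_γ⁰` (a predicate on subgroups of `G(F)`)
  [Prop. 7.1 p. 385] -/
  IsHyperspecialIn : GF → Subgroup GF → Prop
  /-- «`ker[H¹(F, I) → H¹(F, G_γ)]` is trivial», `I = G_γ⁰` [Prop. 7.1 p. 385] -/
  KerH1Trivial : GF → Prop
  /-- for `γ ∈ K` as in 7.1 and a stable conjugate `γ'`: the measure on `G(F) ⧸ C(γ')` induced by `dg/di'` of 7.2
  (`dg(K) = 1`, `di(I(F) ∩ K) = 1`, `di'` on `I'(F)` obtained from `di`) [§7.2 p. 387] -/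
  mOrb : (γ γ' : GF) → Measure (GF ⧸ Subgroup.centralizer ({γ'} : Set GF))
  /-- standing hypothesis of 7.4–7.5: «`G_der` is simply connected» [§7.4 p. 387] -/
  DerSimplyConnected : Prop
  /-- the endoscopic triples `(H, s, η)` for `G` [§7.4 p. 387] -/
  Endo : Type u
  /-- «`H` is an unramified group» [Prop. 7.5 p. 387] -/
  IsUnramifiedH : Endo → Prop
  /-- the semi-simple `(G, H)`-regular elements `γ_H` of `H(F)` [§7.4 p. 387] -/
  SSHreg : Endo → Type u
  /-- «`γ` is a corresponding element of `G(F)`, as in 3.1» [§7.4 p. 387] -/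
  Corresponds : (e : Endo) → SSHreg e → GF → Prop
  /-- the `κ`-orbital integral `O^κ_γ(f)`, `κ ∈ 𝔎(I/F)` obtained from `s` as in 5.6 [§7.4 p. 387] -/
  kappaOrb : (e : Endo) → SSHreg e → GF → (GF → ℂ) → ℂ

namespace LocalFinitenessData

variable {GF : Type u} [Group GF] [TopologicalSpace GF]
  [∀ γ : GF, MeasurableSpace (GF ⧸ Subgroup.centralizer ({γ} : Set GF))] (D : LocalFinitenessData GF)

/-- The hypothesis of 7.1 on `γ`: `γ ∈ K` semi-simple with the root condition. [cite: Kottwitz1986, Proposition 7.1 (p. 385)] -/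
def Hyp71 (γ : GF) : Prop :=
  γ ∈ D.K ∧ D.IsSemisimple γ ∧ D.RootCondition γ

/-! ## §3 The printed statements of §7 as relations over the datum -/

/-- **7.1. PROPOSITION**: «Let `γ` be a semi-simple element of `K` such that `1 − α(γ) ∈ 𝔬_F̄` is either `0` or a unit
for every root `α` of `G`, and let `I = G_γ⁰`. Then `I` is unramified and `I(F) ∩ K` is a hyperspecial maximal
compact subgroup of `I(F)`. Furthermore, `ker[H¹(F, I) → H¹(F, G_γ)]` is trivial. Finally, if `γ' ∈ K` is stably
conjugate to `γ`, then `γ'` is conjugate to `γ` under `K`.», AS A RELATION over the datum (the last clause concrete: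
`γ' = k γ k⁻¹`, `k ∈ K`). Tree instances (theorems): `GL_N` ★ `exists_isUnit_det_conj_of_charpoly_eq`, unitary ★
`exists_integral_unitary_conj_of_charpoly_eq` (`Literature.LinearAlgebra.Matrix`).
[cite: Kottwitz1986, Proposition 7.1 (p. 385)] -/
def Kottwitz1986_7_1 : Prop :=
  ∀ γ : GF, D.Hyp71 γ →
    D.CentUnramified γ ∧ D.IsHyperspecialIn γ (D.IF γ ⊓ D.K) ∧ D.KerH1Trivial γ ∧
      ∀ γ' ∈ D.K, D.IsStConj γ γ' → ∃ k ∈ D.K, γ' = k * γ * k⁻¹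

/-- **Proof of 7.3, the set `X`**: «`X = {g ∈ G(F) | g⁻¹γg ∈ K}` … we see that `X = I(F) · K` in general» (for `γ`
as in 7.1), AS A RELATION over the datum. Tree instance: `GL_N` ★ `mem_range_map_mul_centralizer_of_conj_mem_range`.
[cite: Kottwitz1986, §7.3 (p. 387)] -/
def Kottwitz1986_7_3_conjSet : Prop :=
  ∀ γ : GF, D.Hyp71 γ → {g : GF | g⁻¹ * γ * g ∈ D.K} = (D.IF γ : Set GF) * (D.K : Set GF)

/-- **7.3. COROLLARY**: «The orbital integral `O_{γ'}(f_K)` vanishes unless `γ'` is conjugate to `γ`, in which case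
it equals `1`.» — for `γ` as in 7.1, `γ'` a stable conjugate of `γ`, `f_K = 𝟙_K`, the measure of 7.2; AS A RELATION
over the datum in the tree's `orbitalIntegral` (★ `Automorphic.LocalOrbitalIntegral`). Tree instances on the
cell's unitary groups: ★ `Rogawski1990.UnramifiedStableOrbitalUnitFactorSemisimple`, ★
`Automorphic.UnitOrbitalIntegralFixedPointsVolume`. [cite: Kottwitz1986, Corollary 7.3 (p. 387)] -/
def Kottwitz1986_7_3 : Prop :=
  ∀ γ : GF, D.Hyp71 γ → ∀ γ' : GF, D.IsStConj γ γ' →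
    (¬ IsConj γ γ' → orbitalIntegral γ' ((D.K : Set GF).indicator (1 : GF → ℝ)) (D.mOrb γ γ') = 0) ∧
    (IsConj γ γ' → orbitalIntegral γ' ((D.K : Set GF).indicator (1 : GF → ℝ)) (D.mOrb γ γ') = 1)

/-- **7.5. PROPOSITION** (under 7.4: `G_der` simply connected, `(H, s, η)` an endoscopic triple, `γ_H ∈ H(F)` semisimple
`(G, H)`-regular, `γ ∈ G(F)` corresponding): «Assume that `H` is not an unramified group. Let `f` belong to the Hecke
algebra `ℌ(G(F), K)`. Then `O^κ_γ(f) = 0`.», AS A RELATION over the datum. [cite: Kottwitz1986, Proposition 7.5 (p. 387)] -/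
def Kottwitz1986_7_5 : Prop :=
  D.DerSimplyConnected → ∀ e : D.Endo, ¬ D.IsUnramifiedH e →
    ∀ (γH : D.SSHreg e) (γ : GF), D.Corresponds e γH γ → ∀ f ∈ heckeAlgebra D.K, D.kappaOrb e γH γ f = 0

/-- **The two printed compatibilities of the posited predicates with the group law** (edition 2; offered by
squad seat TK-t10): `I(F) ⊆ C_{G(F)}(γ)` since `I = G_γ⁰ ⊂ G_γ` (p. 385), and conjugacy under `G(F)` implies stable
conjugacy — for every `γ`, an element `g ∈ G(F)` giving the trivial cocycle (the DEFINITION of stable conjugacy of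
[K1] = Kottwitz 1982, recalled on p. 385; not a clause of Prop. 7.1), AS A RELATION over the datum.
[cite: Kottwitz1986, §7 p. 385 (I = G_γ⁰; stable conjugacy as in [K1])] [cite: Kottwitz1982, §3] -/
def PrintedLaws7 : Prop :=
  (∀ γ : GF, D.IF γ ≤ Subgroup.centralizer ({γ} : Set GF)) ∧
  (∀ γ γ' : GF, IsConj γ γ' → D.IsStConj γ γ')

end LocalFinitenessData

/-! ## §4 Edition 2: the map `H¹(F, I) → H¹(F, G_γ)` of 7.1 as posited pointed sets (offered by squad seat TK-t10) -/

/-- **The pointed sets behind «`ker[H¹(F, I) → H¹(F, G_γ)]` is trivial»** (7.1), over a §7 datum `D`: `H¹(F, I)`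
(`I = G_γ⁰`) and `H¹(F, G_γ)` with their distinguished points and the POINTED map induced by `I ↪ G_γ` (`h1Map_pt`) —
the local consumer is the last clause of 7.1 itself (for `γ' ∈ K` stably conjugate to `γ`, `inv(γ, γ')` lies in this
kernel, p. 387); `Compatible` ties it to the carpet's predicate `D.KerH1Trivial`. Datum only; the only `Prop` field
is the pointedness of the map. [cite: Kottwitz1986, Proposition 7.1 (p. 385)] -/
structure H1KernelData {GF : Type u} [Group GF] [TopologicalSpace GF]
    [∀ γ : GF, MeasurableSpace (GF ⧸ Subgroup.centralizer ({γ} : Set GF))]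
    (D : LocalFinitenessData GF) : Type (u + 1) where
  /-- `H¹(F, I)`, `I = G_γ⁰`, as a set [Prop. 7.1 p. 385] -/
  H1I : GF → Type u
  /-- the distinguished point of `H¹(F, I)` [Prop. 7.1 p. 385] -/
  ptI : (γ : GF) → H1I γ
  /-- `H¹(F, G_γ)` as a set [Prop. 7.1 p. 385] -/
  H1C : GF → Type u
  /-- the distinguished point of `H¹(F, G_γ)` [Prop. 7.1 p. 385] -/
  ptC : (γ : GF) → H1C γ
  /-- the map `H¹(F, I) → H¹(F, G_γ)` induced by `I = G_γ⁰ ↪ G_γ` [Prop. 7.1 p. 385] -/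
  h1Map : (γ : GF) → H1I γ → H1C γ
  /-- the map is a morphism of POINTED sets (the trivial cocycle maps to the trivial cocycle) [§1 p. 368; Prop. 7.1 p. 385] -/
  h1Map_pt : ∀ γ : GF, h1Map γ (ptI γ) = ptC γ

namespace H1KernelData

variable {GF : Type u} [Group GF] [TopologicalSpace GF]
  [∀ γ : GF, MeasurableSpace (GF ⧸ Subgroup.centralizer ({γ} : Set GF))] {D : LocalFinitenessData GF}
  (E : H1KernelData D)

/-- «`ker[H¹(F, I) → H¹(F, G_γ)]` is trivial» on the posited pointed map: the kernel IS the distinguished point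
(`↔`; with `h1Map_pt` the `←` direction is automatic). [cite: Kottwitz1986, Proposition 7.1 (p. 385)] -/
def KerTrivial (γ : GF) : Prop :=
  ∀ x : E.H1I γ, E.h1Map γ x = E.ptC γ ↔ x = E.ptI γ

/-- Compatibility of the carpet's predicate `D.KerH1Trivial` with the pointed-set reading `E.KerTrivial`, AS A
RELATION. [cite: Kottwitz1986, Proposition 7.1 (p. 385)] -/
def Compatible : Prop :=
  ∀ γ : GF, D.KerH1Trivial γ ↔ E.KerTrivial γ

end H1KernelData

end Literature.NumberTheory.Kottwitz1986.LocalFiniteness
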